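import Summits.AtomisticToContinuum.HydrodynamicLimit.Theses.CollisionIsometryCLT
import Literature.Analysis.FluidPDE.HardSphereFlowConstruction

/-!
# Sketch — crux idea `energy-pedigree-transport` for `AprioriBounds` (i) (stmt-AtomisticToContinuum-9519)

crux-ideate round 1, ideator 3 (gen 2), planner-cruxidea-stmt-AtomisticToContinuum-9519-3-g2-0.

First lemmas of the line (all over existing declarations):

* `cosSq`, `cosSq_nonneg`, `cosSq_le_one` — the squared direction cosine `⟪v,n⟫²/(‖n‖²‖v‖²)`
  (junk-safe: `0` when `v = 0` or `n = 0`).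
* `energy_exchange_fst/snd` (PROVED): at an elastic reflection `reflectVel n (v, w)` the two
  post-collisional LAB energies are NON-NEGATIVE combinations of the pre-collisional ones,
  `‖v'‖² = (1 - c_v)‖v‖² + c_w‖w‖²`, `‖w'‖² = c_v‖v‖² + (1 - c_w)‖w‖²`, `c_v = cosSq n v`,
  `c_w = cosSq n w` — a COLUMN-STOCHASTIC 2×2 rule (energy conservation) whose coefficients are
  direction cosines in `[0,1]`, blind to the speeds.
* `domination_step` (PROVED): the rule is monotone, so any field transported by the same rule from
  data dominating the energies keeps dominating them; `exchangeStep`, `exchangeStep_dominates`,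
  `foldl_exchange_dominates` (PROVED): the abstract fold of exchange events preserves `a ≤ e · A`
  (the induction behind `EnergyDomination`); `sum_exchangeStep` (PROVED): each event conserves
  the total (column-stochasticity).
* `concField` — the transported CONCENTRATION FIELD `R^ζ`: the scalar rule folded over the
  Alexander collision sequence of the initial configuration (same fold as the route's transfer
  `M` in `TransferIsometry` / `AdaptedWeightCLT`), typed over existing declarations.
* `EnergyDomination σ` (stub, provable now modulo the bookkeeping of `TransferRepresentsFlow`):
  `‖vᵢ(s)‖² ≤ e · R^ζᵢ(s)` with `ζₖ = max(1, ‖vₖ(0)‖²/e)`.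
* `RTail` (THE stub of the line): the time-averaged empirical exponential moment of `R^ζ` is
  bounded w.h.p. under the local Gibbs law.
* `partI_of_RTail` (signature; the composition is monotonicity of `exp` and of the integrals,
  with `λ = μ/e`).
-/

noncomputable section

open MeasureTheory Filter Set Topology
open scoped InnerProductSpace BigOperators ENNReal

namespace Summit.AtomisticToContinuum.HydrodynamicLimit.Cruxes.AprioriBounds.IdeatorThreeG2

open Literature.Analysis.FluidPDE Literature.MathematicalPhysics.KineticTheory

section Kinematics

variable {E : Type*} [NormedAddCommGroup E] [InnerProductSpace ℝ E]

/-- Squared direction cosine of `v` against the impact direction `n`: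
`cosSq n v = ⟪v, n⟫² / (‖n‖² ‖v‖²)` (`= 0` if `v = 0` or `n = 0`, Lean's `x / 0 = 0`). -/
def cosSq (n v : E) : ℝ := ⟪v, n⟫_ℝ ^ 2 / (‖n‖ ^ 2 * ‖v‖ ^ 2)

theorem cosSq_nonneg (n v : E) : 0 ≤ cosSq n v := by
  unfold cosSq; positivity

theorem cosSq_le_one (n v : E) : cosSq n v ≤ 1 := by
  unfold cosSq
  have hcs : ⟪v, n⟫_ℝ ^ 2 ≤ ‖n‖ ^ 2 * ‖v‖ ^ 2 := by
    have h := abs_real_inner_le_norm v n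
    calc ⟪v, n⟫_ℝ ^ 2 = |⟪v, n⟫_ℝ| ^ 2 := (sq_abs _).symm
      _ ≤ (‖v‖ * ‖n‖) ^ 2 := pow_le_pow_left₀ (abs_nonneg _) h 2
      _ = ‖n‖ ^ 2 * ‖v‖ ^ 2 := by ring
  by_cases h0 : ‖n‖ ^ 2 * ‖v‖ ^ 2 = 0
  · rw [h0, div_zero]; exact zero_le_one
  · exact (div_le_one (lt_of_le_of_ne (by positivity) (Ne.symm h0))).2 hcs

theorem cosSq_mem_Icc (n v : E) : cosSq n v ∈ Icc (0 : ℝ) 1 :=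
  ⟨cosSq_nonneg n v, cosSq_le_one n v⟩

/-- `cosSq n v · ‖v‖² = ⟪v,n⟫²/‖n‖²` (also when `v = 0`). -/
theorem cosSq_mul_norm_sq (n v : E) : cosSq n v * ‖v‖ ^ 2 = ⟪v, n⟫_ℝ ^ 2 / ‖n‖ ^ 2 := by
  unfold cosSq
  by_cases hv : v = 0
  · simp [hv]
  have hv' : ‖v‖ ^ 2 ≠ 0 := pow_ne_zero 2 (norm_ne_zero_iff.2 hv)
  rw [div_mul_eq_mul_div, mul_comm (‖n‖ ^ 2) (‖v‖ ^ 2), ← div_div, mul_div_assoc, div_self hv',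
    mul_one]

/-- **Normal swap** (lab energy of the first particle after the reflection). -/
theorem norm_sq_reflectVel_fst (n : E) (hn : n ≠ 0) (v w : E) :
    ‖(reflectVel n (v, w)).1‖ ^ 2 = ‖v‖ ^ 2 - ⟪v, n⟫_ℝ ^ 2 / ‖n‖ ^ 2 + ⟪w, n⟫_ℝ ^ 2 / ‖n‖ ^ 2 := by
  have hn2 : ‖n‖ ^ 2 ≠ 0 := pow_ne_zero 2 (norm_ne_zero_iff.2 hn)
  simp only [reflectVel]
  rw [norm_sub_sq_real, inner_smul_right, norm_smul, Real.norm_eq_abs, mul_pow, sq_abs,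
    inner_sub_left]
  field_simp
  ring

/-- **Energy exchange, first particle**: `‖v'‖² = (1 - cosSq n v) ‖v‖² + cosSq n w ‖w‖²`. -/
theorem energy_exchange_fst (n v w : E) :
    ‖(reflectVel n (v, w)).1‖ ^ 2 = (1 - cosSq n v) * ‖v‖ ^ 2 + cosSq n w * ‖w‖ ^ 2 := by
  by_cases hn : n = 0
  · subst hn; simp [cosSq]
  rw [norm_sq_reflectVel_fst n hn, sub_mul, one_mul, cosSq_mul_norm_sq, cosSq_mul_norm_sq]

/-- **Energy exchange, second particle**: `‖w'‖² = cosSq n v ‖v‖² + (1 - cosSq n w) ‖w‖²`. -/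
theorem energy_exchange_snd (n v w : E) :
    ‖(reflectVel n (v, w)).2‖ ^ 2 = cosSq n v * ‖v‖ ^ 2 + (1 - cosSq n w) * ‖w‖ ^ 2 := by
  have hcons := norm_sq_reflectVel_fst_add_norm_sq_reflectVel_snd n (v, w)
  have h1 := energy_exchange_fst n v w
  simp only at hcons
  linarith

/-- The exchange rule is COLUMN-STOCHASTIC: total energy is conserved and each pre-collisional
energy is split with fractions in `[0,1]` (restated for the record). -/
theorem energy_exchange_conserves (n v w : E) :
    ‖(reflectVel n (v, w)).1‖ ^ 2 + ‖(reflectVel n (v, w)).2‖ ^ 2 = ‖v‖ ^ 2 + ‖w‖ ^ 2 := by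
  rw [energy_exchange_fst, energy_exchange_snd]; ring

/-- **Domination step**: the scalar rule is monotone for nonnegative coefficients, so a field
transported by the same rule from dominating data keeps dominating. -/
theorem domination_step {a b A B e c₁ c₂ : ℝ} (hc₁ : c₁ ∈ Icc (0 : ℝ) 1) (hc₂ : c₂ ∈ Icc (0 : ℝ) 1)
    (ha : a ≤ e * A) (hb : b ≤ e * B) :
    (1 - c₁) * a + c₂ * b ≤ e * ((1 - c₁) * A + c₂ * B) ∧
      c₁ * a + (1 - c₂) * b ≤ e * (c₁ * A + (1 - c₂) * B) := by
  obtain ⟨h1, h1'⟩ := hc₁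
  obtain ⟨h2, h2'⟩ := hc₂
  constructor
  · have e1 : (1 - c₁) * a ≤ (1 - c₁) * (e * A) := mul_le_mul_of_nonneg_left ha (by linarith)
    have e2 : c₂ * b ≤ c₂ * (e * B) := mul_le_mul_of_nonneg_left hb h2
    linarith
  · have e1 : c₁ * a ≤ c₁ * (e * A) := mul_le_mul_of_nonneg_left ha h1
    have e2 : (1 - c₂) * b ≤ (1 - c₂) * (e * B) := mul_le_mul_of_nonneg_left hb (by linarith)
    linarith

end Kinematics

/-! ### The abstract exchange fold preserves domination and total mass -/

section Fold

variable {ι : Type*} [DecidableEq ι]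

/-- One scalar exchange event on a field `F : ι → ℝ` at the ordered pair `(i, j)` with fractions
`(c₁, c₂)`: `F i ← (1 - c₁) F i + c₂ F j`, `F j ← c₁ F i + (1 - c₂) F j` (pre-event values on the
right; this is the update performed by `concField` at each collision). -/
def exchangeStep (i j : ι) (c₁ c₂ : ℝ) (F : ι → ℝ) : ι → ℝ :=
  Function.update (Function.update F i ((1 - c₁) * F i + c₂ * F j)) j (c₁ * F i + (1 - c₂) * F j)

theorem exchangeStep_apply_right (i j : ι) (c₁ c₂ : ℝ) (F : ι → ℝ) :
    exchangeStep i j c₁ c₂ F j = c₁ * F i + (1 - c₂) * F j := by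
  simp [exchangeStep]

theorem exchangeStep_apply_left {i j : ι} (hij : i ≠ j) (c₁ c₂ : ℝ) (F : ι → ℝ) :
    exchangeStep i j c₁ c₂ F i = (1 - c₁) * F i + c₂ * F j := by
  simp [exchangeStep, Function.update_of_ne hij]

theorem exchangeStep_apply_of_ne {i j k : ι} (hki : k ≠ i) (hkj : k ≠ j) (c₁ c₂ : ℝ) (F : ι → ℝ) :
    exchangeStep i j c₁ c₂ F k = F k := by
  simp [exchangeStep, Function.update_of_ne hki, Function.update_of_ne hkj]

/-- **One event preserves domination** `a ≤ e · A` (pointwise), for fractions in `[0,1]`. -/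
theorem exchangeStep_dominates {i j : ι} (hij : i ≠ j) {c₁ c₂ e : ℝ} (hc₁ : c₁ ∈ Icc (0 : ℝ) 1)
    (hc₂ : c₂ ∈ Icc (0 : ℝ) 1) {a A : ι → ℝ} (h : ∀ k, a k ≤ e * A k) :
    ∀ k, exchangeStep i j c₁ c₂ a k ≤ e * exchangeStep i j c₁ c₂ A k := by
  intro k
  have hd := domination_step (a := a i) (b := a j) (A := A i) (B := A j) (e := e) hc₁ hc₂ (h i) (h j)
  by_cases hkj : k = j
  · subst hkj
    rw [exchangeStep_apply_right, exchangeStep_apply_right]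
    exact hd.2
  by_cases hki : k = i
  · subst hki
    rw [exchangeStep_apply_left hij, exchangeStep_apply_left hij]
    exact hd.1
  rw [exchangeStep_apply_of_ne hki hkj, exchangeStep_apply_of_ne hki hkj]
  exact h k

/-- **The whole fold preserves domination**: folding any list of admissible events (distinct pair,
fractions in `[0,1]`) over the energies `a` and over the field `A` from dominating data keeps
`a ≤ e · A` — the induction behind `EnergyDomination` (what remains there is only the
identification of the flow's velocities with the Alexander fold, as in `TransferRepresentsFlow`). -/
theorem foldl_exchange_dominates (evs : List (ι × ι × ℝ × ℝ))
    (hev : ∀ ev ∈ evs, ev.1 ≠ ev.2.1 ∧ ev.2.2.1 ∈ Icc (0 : ℝ) 1 ∧ ev.2.2.2 ∈ Icc (0 : ℝ) 1)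
    {e : ℝ} {a A : ι → ℝ} (h : ∀ k, a k ≤ e * A k) :
    ∀ k, (evs.foldl (fun F ev => exchangeStep ev.1 ev.2.1 ev.2.2.1 ev.2.2.2 F) a) k ≤
      e * (evs.foldl (fun F ev => exchangeStep ev.1 ev.2.1 ev.2.2.1 ev.2.2.2 F) A) k := by
  induction evs generalizing a A with
  | nil => simpa using h
  | cons ev evs ih =>
    simp only [List.foldl_cons]
    have hev0 := hev ev (List.mem_cons.2 (Or.inl rfl))
    exact ih (fun ev' hev' => hev ev' (List.mem_cons.2 (Or.inr hev')))
      (exchangeStep_dominates hev0.1 hev0.2.1 hev0.2.2 h)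

/-- **One event conserves the total** (column-stochasticity): `Σₖ F' k = Σₖ F k` on a finite index
type, for a distinct pair. -/
theorem sum_exchangeStep [Fintype ι] {i j : ι} (hij : i ≠ j) (c₁ c₂ : ℝ) (F : ι → ℝ) :
    ∑ k, exchangeStep i j c₁ c₂ F k = ∑ k, F k := by
  classical
  have hj : j ∈ Finset.univ.erase i := Finset.mem_erase.2 ⟨hij.symm, Finset.mem_univ j⟩
  rw [← Finset.add_sum_erase _ _ (Finset.mem_univ i), ← Finset.add_sum_erase _ _ hj,
    ← Finset.add_sum_erase _ _ (Finset.mem_univ i), ← Finset.add_sum_erase _ _ hj]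
  have hrest : ∑ k ∈ (Finset.univ.erase i).erase j, exchangeStep i j c₁ c₂ F k =
      ∑ k ∈ (Finset.univ.erase i).erase j, F k := by
    refine Finset.sum_congr rfl fun k hk => ?_
    have hkj : k ≠ j := (Finset.mem_erase.1 hk).1
    have hki : k ≠ i := (Finset.mem_erase.1 (Finset.mem_erase.1 hk).2).1
    exact exchangeStep_apply_of_ne hki hkj c₁ c₂ F
  rw [hrest, exchangeStep_apply_left hij, exchangeStep_apply_right]
  ring

end Fold

/-! ## The transported concentration field and the stubs of the line -/

/-- The transported field: fold of the scalar energy-exchange rule over the Alexander collision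
sequence of the initial configuration `y` on the window `[0, Δ]`, started from the data `ζ`
(same fold, same pair selection `h.some`, same pre-collisional configurations `pre k` as the
route's frozen-geometry transfer `M`). With `ζ ≡ 1` this is the CONCENTRATION FIELD `R`
("luck"); with `ζ = ‖v(0)‖²` it is the lab energy itself (`EnergyDomination` with equality). -/
def concField (σ : ℝ) (N : ℕ) (y : Config (N + 1) (Fin 3) T3) (Δ : ℝ) (ζ : Fin (N + 1) → ℝ) :
    Fin (N + 1) → ℝ :=
  let G := Torus.geometry (Fin 3)
  let ε : ℝ := hsDiameter σ N
  let pre := fun k : ℕ =>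
    (let zk := Alexander.stateAfter G ε y k
     freeFlight G (Alexander.freeExitTime G ε zk).toReal zk)
  (List.range (Alexander.collisionCount G ε y Δ)).foldl
    (fun R k =>
      @dite (Fin (N + 1) → ℝ) (Alexander.incomingPairs G ε (pre k)).Nonempty
        (Classical.propDecidable _)
        (fun h =>
          let i := h.some.1
          let j := h.some.2
          let n := G.sepVec (pre k i).1 (pre k j).1
          let ci := cosSq n (pre k i).2
          let cj := cosSq n (pre k j).2
          exchangeStep i j ci cj R)
        (fun _ => R))
    ζ

/-- The near-unit data `ζₖ = max(1, ‖vₖ‖²/e)` (equal to `1` off the initially `e`-hot particles). -/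
def zetaData (e : ℝ) {N : ℕ} (y : Config (N + 1) (Fin 3) T3) : Fin (N + 1) → ℝ :=
  fun k => max 1 (‖(y k).2‖ ^ 2 / e)

/-- STUB `EnergyDomination` (bookkeeping, provable now along the lines of the support item
`TransferRepresentsFlow`): along Liouville-a.e. orbit of any hard-sphere flow, every lab energy
at time `s ≥ 0` is dominated by `e ·` the field transported from `ζ = max(1, ‖v(0)‖²/e)`:
induction on the collision count with `energy_exchange_fst/snd` + `domination_step`. -/
def EnergyDomination (σ : ℝ) : Prop :=
  ∀ (N : ℕ) (Φ : HardSphereFlow (Torus.geometry (Fin 3)) (hsDiameter σ N) (N + 1)) (e : ℝ), 0 < e →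
    ∀ s : ℝ, 0 ≤ s →
      ∀ᵐ z ∂(liouville (Torus.geometry (Fin 3)) (N + 1) (hsDiameter σ N)),
        ∀ i : Fin (N + 1), ‖(Φ.flow s z i).2‖ ^ 2 ≤ e * concField σ N z s (zetaData e z) i

/-- STUB `RTail` — THE crux of the line: the time-averaged empirical exponential moment of the
transported concentration field is bounded with probability `→ 1` under the local Gibbs law,
for SOME rate `μ > 0` and SOME threshold `e > 0` (data `ζ ≡ 1` except on the initially `e`-hot
particles). Same quantifier prefix as the crux; `μ, e, C` after `t` and `Φ` (as `λ, C` there). -/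
def RTail : Prop :=
  ∀ (a₀ θ₀ : T3 → ℝ) (u₀ : T3 → V3), Continuous a₀ → Continuous θ₀ → Continuous u₀ →
    (∀ x, 0 < a₀ x) → (∀ x, 0 < θ₀ x) → ∃ σ₀ : ℝ, 0 < σ₀ ∧ ∀ σ : ℝ, 0 < σ → σ < σ₀ →
    ∀ Φ : (N : ℕ) → HardSphereFlow (Torus.geometry (Fin 3)) (hsDiameter σ N) (N + 1),
    ∀ t : ℝ, 0 < t → ∃ e μ C : ℝ, 0 < e ∧ 0 < μ ∧
      Tendsto (fun N : ℕ => localGibbsLaw σ a₀ u₀ θ₀ N (Φ N)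
        {z | C < ∫ s in Icc 0 t, ((N + 1 : ℕ) : ℝ)⁻¹ *
          ∑ i : Fin (N + 1), Real.exp (μ * concField σ N z s (zetaData e z) i)}) atTop (𝓝 0)

/-- Part (i) of the crux under its prefix (projection of `AprioriBounds`, verbatim body). -/
def AprioriBoundsI : Prop :=
  ∀ (a₀ θ₀ : T3 → ℝ) (u₀ : T3 → V3), Continuous a₀ → Continuous θ₀ → Continuous u₀ →
    (∀ x, 0 < a₀ x) → (∀ x, 0 < θ₀ x) → ∃ σ₀ : ℝ, 0 < σ₀ ∧ ∀ σ : ℝ, 0 < σ → σ < σ₀ →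
    ∀ Φ : (N : ℕ) → HardSphereFlow (Torus.geometry (Fin 3)) (hsDiameter σ N) (N + 1),
    ∀ t : ℝ, 0 < t → ∃ lam Cexp : ℝ, 0 < lam ∧
      Tendsto (fun N : ℕ => localGibbsLaw σ a₀ u₀ θ₀ N (Φ N)
        {z | Cexp < ∫ s in Icc 0 t, ∫ y, Real.exp (lam * ‖y.2‖ ^ 2)
          ∂(empiricalMeasure ((Φ N).flow s z))}) atTop (𝓝 0)

/-- The crux hands out part (i) (pure logic, projection `.1`). -/
theorem aprioriBoundsI_of_aprioriBounds
    (h : Summit.AtomisticToContinuum.HydrodynamicLimit.Theses.CollisionIsometryCLT.AprioriBounds) :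
    AprioriBoundsI := by
  intro a₀ θ₀ u₀ ha hθ hu ha0 hθ0
  obtain ⟨σ₀, hσ₀, hσ⟩ := h a₀ θ₀ u₀ ha hθ hu ha0 hθ0
  exact ⟨σ₀, hσ₀, fun σ h0 h1 Φ t ht => (hσ σ h0 h1 Φ t ht).1⟩

/-- COMPOSITION (signature only; the line's concluding theorem for part (i)): `RTail` and the
domination bookkeeping give part (i) with `λ := μ / e`, `Cexp := C`, because
`exp(λ‖vᵢ(s)‖²) ≤ exp(μ R^ζᵢ(s))` pointwise (monotonicity), the empirical integral is the finite
average (`integral_empiricalMeasure`), the local Gibbs law is absolutely continuous with respect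
to Liouville, and the Bochner integrals over `Icc 0 t` are of step functions on good orbits. -/
theorem partI_of_RTail (hR : RTail) (hD : ∀ σ, 0 < σ → σ < 2⁻¹ → EnergyDomination σ) :
    AprioriBoundsI := by
  sorry

end Summit.AtomisticToContinuum.HydrodynamicLimit.Cruxes.AprioriBounds.IdeatorThreeG2

end
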